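import Mathlib
import Summits.ValiantsHypothesis.ValiantsHypothesis.Theses.LiouvilleSarnak
import Summits.ValiantsHypothesis.ValiantsHypothesis.Theorems.LiouvilleSarnakLiouvilleCutRankOneBlock

/-!
# Route LiouvilleSarnak — crux `LiouvilleCutRank` (stmt-ValiantsHypothesis-14775):
# an ENTROPY CRITERION valid for every cut at once

The crux `LiouvilleCutRank`: for every `W`, eventually EVERY balanced cut matrix
`M_π(r, c) = λ(N_π(r, c) + 1)` (`π : Fin n ⊕ Fin n ≃ Fin (2n)` assigns row/column bits, `λ` = Liouville,
`N_π(r, c) = Nat.ofBits (Sum.elim r c ∘ π.symm)`) has rank `≥ W` over `ℂ`.  The tree already reduced it to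
its ONE-BLOCK form (`OneBlock.liouvilleCutRank_iff_oneBlock_distinctRows`: for every `D` one scale `n₁` at
which every balanced cut word `π₁` sees `≥ D` distinct row patterns in SOME aligned block
`[4^{n₁} H + 1, 4^{n₁} (H + 1)]` of `λ`).

This file adds a COUNTING step and obtains a criterion in which the cut word no longer appears:

* §1 `card_le_of_card_image_rows_le` — a finite set `S` of `±1` patterns `p : ι → ℤ` each of which,
  read as an `X × X` matrix through a surjective addressing `N : X → X → ι`, has `≤ E` distinct rows,
  has `#S ≤ (E + 1)^{#X} · 2^{#X · (E + 1)}`: a pattern is recovered from (row ↦ index of its row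
  pattern, index ↦ row pattern).  For `#X = 2^t` and `ι = Fin 4^t` this is `2^{O_E(2^t)} = 2^{O_E(√B)}`
  patterns of length `B = 4^t` — exponentially few.
* §2 `exists_cutPair_eq`, `card_image_blockRows_eq` — bookkeeping: every address `i < 4^t` is some
  `N_{π₁}(r, c)`; distinct `ℂ`-rows = distinct `ℤ`-rows.
* §3 ★ `liouvilleCutRank_of_blockComplexity` — **if for every `C` there is a block length `B = 4^t` such
  that the Liouville sequence shows MORE than `2^{C · 2^t} = 2^{C √B}` distinct sign patterns on the
  aligned blocks `[4^t H + 1, 4^t (H + 1)]`, `H < H₀`, then `LiouvilleCutRank` holds.**  (Given `D`, take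
  `C = 2D`; if some balanced cut word `π₁` at level `t` saw `< D` distinct rows in EVERY aligned block, §1
  would cap the number of block patterns by `D^{2^t} · 2^{2^t D} ≤ 2^{2D · 2^t}`.)
* §4 ★ `liouvilleCutRank_of_patternEntropy` — in particular **positive sign-pattern entropy of `λ`**
  (`∃ η > 0`: for all large `L`, `λ` has `≥ 2^{η L}` distinct sign patterns of length `L`) **implies
  `LiouvilleCutRank`**: a window of length `B` at position `x = BH + i` is determined by `i < B` and the
  two aligned blocks `H`, `H + 1`, so `p(B) ≤ B · a(B)²` where `a(B)` counts aligned block patterns.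

Placement.  The tree's conditional bridge `LiouvilleCutRankChowla.liouvilleCutRank_of_chowla`
(Chowla ⇒ every finite sign pattern occurs ⇒ crux) needs ALL `2^B` patterns; the criterion here needs
only `2^{C√B}` of them for every `C`, i.e. it places the crux BELOW "λ has positive entropy" (a
consequence of Sarnak's conjecture, since `λ` correlates with `μ`), and far below Chowla.  The
hypothesis is still OPEN (the best lower bounds in print for the subword complexity of `λ` are
super-linear, Frantzikinakis–Host), so this is a conditional bridge, not a closure.

Honest framing: `LiouvilleCutRank`, `DigitalBilinearLiouville` and `AlgebraicSarnak` stay OPEN, and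
nothing here bears on VP versus VNP.  No definitions (both hypotheses are written out verbatim).
-/

-- the directory `ValiantsHypothesis/ValiantsHypothesis` repeats the summit name (tree layout)
set_option linter.dupNamespace false

namespace Summit.ValiantsHypothesis.ValiantsHypothesis.Theorems.LiouvilleSarnakLiouvilleCutRank.BlockEntropy

open Finset ArithmeticFunction

open Summit.ValiantsHypothesis.ValiantsHypothesis.Theses.LiouvilleSarnak (LiouvilleCutRank)
open Summit.ValiantsHypothesis.ValiantsHypothesis.Theorems.LiouvilleSarnakLiouvilleCutRank.OneBlock
  (liouvilleCutRank_iff_oneBlock_distinctRows)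

/-! ### §1 Few distinct rows ⇒ few patterns -/

/-- **Counting lemma.**  Let `N : X → X → ι` hit every address, and let `S` be a finite set of `±1`
patterns `p : ι → ℤ` such that each `p ∈ S`, read as the matrix `(r, c) ↦ p (N r c)`, has at most `E`
distinct rows.  Then `#S ≤ (E + 1)^{#X} · 2^{#X (E + 1)}`: the map
`p ↦ (r ↦ index of row r among the rows of p, j ↦ j-th row of p as a Boolean vector)` into
`(X → Fin (E + 1)) × (Fin (E + 1) → X → Bool)` is injective on `S`. [folklore] -/
theorem card_le_of_card_image_rows_le {X ι : Type*} [Fintype X] [DecidableEq X] [Fintype ι]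
    [DecidableEq ι] (N : X → X → ι) (hN : ∀ i, ∃ r c, N r c = i) (E : ℕ) (S : Finset (ι → ℤ))
    (hpm : ∀ p ∈ S, ∀ i, p i = 1 ∨ p i = -1)
    (hrows : ∀ p ∈ S, (univ.image fun r : X => fun c : X => p (N r c)).card ≤ E) :
    S.card ≤ (E + 1) ^ Fintype.card X * 2 ^ (Fintype.card X * (E + 1)) := by
  classical
  -- the rows of a pattern, and their finite set
  let row : (ι → ℤ) → X → X → ℤ := fun p r c => p (N r c)
  let R : (ι → ℤ) → Finset (X → ℤ) := fun p => univ.image (row p)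
  have hmem : ∀ p r, row p r ∈ R p := fun p r => mem_image_of_mem _ (mem_univ r)
  -- index of a row (truncated at `E`, harmless on `S`) and the table of rows as Boolean vectors
  let ψ : (ι → ℤ) → X → Fin (E + 1) := fun p r =>
    ⟨min (((R p).equivFin ⟨row p r, hmem p r⟩ : Fin (R p).card) : ℕ) E, by omega⟩
  let ρ : (ι → ℤ) → Fin (E + 1) → X → Bool := fun p j c =>
    if h : (j : ℕ) < (R p).card then decide (((R p).equivFin.symm ⟨j, h⟩ : X → ℤ) c = 1) else false
  have hρψ : ∀ p ∈ S, ∀ r c, ρ p (ψ p r) c = decide (row p r c = 1) := by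
    intro p hp r c
    have hlt : (((R p).equivFin ⟨row p r, hmem p r⟩ : Fin (R p).card) : ℕ) < (R p).card := Fin.isLt _
    have hle : (R p).card ≤ E := hrows p hp
    have hmin : min (((R p).equivFin ⟨row p r, hmem p r⟩ : Fin (R p).card) : ℕ) E =
        (((R p).equivFin ⟨row p r, hmem p r⟩ : Fin (R p).card) : ℕ) := min_eq_left (by omega)
    simp only [ψ, ρ, hmin, hlt, dite_true, Fin.eta, Equiv.symm_apply_apply]
  have hinj : Set.InjOn (fun p => (ψ p, ρ p)) ↑S := by
    intro p hp q hq hpq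
    simp only [Prod.mk.injEq] at hpq
    obtain ⟨hψ, hρ⟩ := hpq
    funext i
    obtain ⟨r, c, rfl⟩ := hN i
    have h1 := hρψ p hp r c
    have h2 := hρψ q hq r c
    rw [hψ, hρ] at h1
    rw [h1] at h2
    have h3 : (row p r c = 1) ↔ (row q r c = 1) := by simpa using h2
    change row p r c = row q r c
    rcases hpm p hp (N r c) with hp1 | hp1 <;> rcases hpm q hq (N r c) with hq1 | hq1
    · exact hp1.trans hq1.symm
    · exact absurd (h3.mp hp1) (by change q (N r c) ≠ 1; rw [hq1]; decide)
    · exact absurd (h3.mpr hq1) (by change p (N r c) ≠ 1; rw [hp1]; decide)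
    · exact hp1.trans hq1.symm
  calc S.card ≤ (univ : Finset ((X → Fin (E + 1)) × (Fin (E + 1) → X → Bool))).card :=
        card_le_card_of_injOn _ (fun _ _ => mem_coe.mpr (mem_univ _)) hinj
    _ = (E + 1) ^ Fintype.card X * 2 ^ (Fintype.card X * (E + 1)) := by
        rw [card_univ, Fintype.card_prod, Fintype.card_fun, Fintype.card_fun, Fintype.card_fun,
          Fintype.card_fin, Fintype.card_bool, ← pow_mul]

/-! ### §2 Addresses and rows of an aligned block read through a cut word -/

/-- Every address `i < 4^t` is `N_{π₁}(r, c)` for some row bits `r` and column bits `c` (read the bits of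
`i` off the positions `π₁` assigns). [folklore] -/
theorem exists_cutPair_eq (t : ℕ) (π₁ : Fin t ⊕ Fin t ≃ Fin (2 * t)) (i : Fin (2 ^ (2 * t))) :
    ∃ r c : Fin t → Bool,
      (⟨Nat.ofBits (fun j : Fin (2 * t) => Sum.elim r c (π₁.symm j)), Nat.ofBits_lt_two_pow _⟩ :
        Fin (2 ^ (2 * t))) = i := by
  refine ⟨fun k => (i : ℕ).testBit (π₁ (Sum.inl k)), fun k => (i : ℕ).testBit (π₁ (Sum.inr k)), ?_⟩
  apply Fin.ext
  have hfun : (fun j : Fin (2 * t) =>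
      Sum.elim (fun k => (i : ℕ).testBit (π₁ (Sum.inl k))) (fun k => (i : ℕ).testBit (π₁ (Sum.inr k)))
        (π₁.symm j)) = fun j : Fin (2 * t) => (i : ℕ).testBit j := by
    funext j
    rcases h : π₁.symm j with k | k
    · have hk : π₁ (Sum.inl k) = j := by rw [← h, Equiv.apply_symm_apply]
      simp [hk]
    · have hk : π₁ (Sum.inr k) = j := by rw [← h, Equiv.apply_symm_apply]
      simp [hk]
  simp only [hfun]
  apply Nat.eq_of_testBit_eq
  intro j
  by_cases hj : j < 2 * t
  · rw [Nat.testBit_ofBits_lt _ _ hj]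
  · rw [Nat.testBit_ofBits_ge _ _ (not_lt.mp hj), Nat.testBit_lt_two_pow]
    exact i.isLt.trans_le (Nat.pow_le_pow_right Nat.two_pos (not_lt.mp hj))

/-- The values `λ(m + 1)` are `±1`. [folklore] -/
theorem liouville_succ_eq_or (m : ℕ) : liouville (m + 1) = 1 ∨ liouville (m + 1) = -1 := by
  rw [liouville_apply (Nat.succ_ne_zero _)]
  exact neg_one_pow_eq_or ℤ _

/-- Distinct `ℂ`-valued rows of an aligned block matrix = distinct `ℤ`-valued rows (the cast `ℤ → ℂ` is
injective). [folklore] -/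
theorem card_image_blockRows_eq (t H : ℕ) (π₁ : Fin t ⊕ Fin t ≃ Fin (2 * t)) :
    (univ.image fun r : Fin t → Bool => fun c : Fin t → Bool =>
        (((liouville (Nat.ofBits (fun j : Fin (2 * t) => Sum.elim r c (π₁.symm j)) +
          2 ^ (2 * t) * H + 1) : ℤ) : ℂ))).card =
      (univ.image fun r : Fin t → Bool => fun c : Fin t → Bool =>
        (liouville (Nat.ofBits (fun j : Fin (2 * t) => Sum.elim r c (π₁.symm j)) +
          2 ^ (2 * t) * H + 1) : ℤ)).card := by
  classical
  have hcomp : (fun r : Fin t → Bool => fun c : Fin t → Bool =>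
        (((liouville (Nat.ofBits (fun j : Fin (2 * t) => Sum.elim r c (π₁.symm j)) +
          2 ^ (2 * t) * H + 1) : ℤ) : ℂ))) =
      (fun f : (Fin t → Bool) → ℤ => fun c => ((f c : ℤ) : ℂ)) ∘
        (fun r : Fin t → Bool => fun c : Fin t → Bool =>
          (liouville (Nat.ofBits (fun j : Fin (2 * t) => Sum.elim r c (π₁.symm j)) +
            2 ^ (2 * t) * H + 1) : ℤ)) := rfl
  rw [hcomp, ← image_image]
  refine card_image_of_injective _ ?_
  intro f g hfg
  funext c
  have := congrFun hfg c
  simp only at this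
  exact_mod_cast this

/-! ### §3 The entropy criterion -/

/-- ★ **Block-complexity criterion for `LiouvilleCutRank`.**  Suppose that for every `C` there are
`t, H₀` such that the Liouville sequence has MORE than `2^{C · 2^t}` distinct sign patterns on the aligned
blocks `[4^t H + 1, 4^t (H + 1)]`, `H < H₀` (i.e. more than `2^{C√B}` patterns of length `B = 4^t`).
Then `LiouvilleCutRank` holds: for every `W`, eventually every balanced cut matrix of `λ` has rank
`≥ W`.  Proof: by `OneBlock.liouvilleCutRank_iff_oneBlock_distinctRows` it suffices, given `D`, to find a
scale `t` at which every balanced cut word `π₁` sees `≥ D` distinct rows in SOME aligned `4^t`-block;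
take `C = 2D`; if all blocks `H < H₀` had `< D` distinct `π₁`-rows, §1 would give at most
`D^{2^t} · 2^{2^t D} ≤ 2^{2D · 2^t}` block patterns. [folklore] -/
theorem liouvilleCutRank_of_blockComplexity
    (h : ∀ C : ℕ, ∃ t H₀ : ℕ, 2 ^ (C * 2 ^ t) <
      ((range H₀).image fun H : ℕ => fun i : Fin (2 ^ (2 * t)) =>
        (liouville (2 ^ (2 * t) * H + i + 1) : ℤ)).card) :
    LiouvilleCutRank := by
  classical
  rw [liouvilleCutRank_iff_oneBlock_distinctRows]
  intro D
  obtain ⟨t, H₀, hbig⟩ := h (2 * D)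
  refine ⟨t, fun π₁ => ?_⟩
  by_contra hcon
  push Not at hcon
  -- every aligned block has `< D` distinct `π₁`-rows; in particular `1 ≤ D`
  have hD : 1 ≤ D := by
    have := hcon 0
    omega
  set S : Finset (Fin (2 ^ (2 * t)) → ℤ) := (range H₀).image fun H : ℕ =>
      fun i : Fin (2 ^ (2 * t)) => (liouville (2 ^ (2 * t) * H + i + 1) : ℤ) with hS
  let N : (Fin t → Bool) → (Fin t → Bool) → Fin (2 ^ (2 * t)) := fun r c =>
    ⟨Nat.ofBits (fun j : Fin (2 * t) => Sum.elim r c (π₁.symm j)), Nat.ofBits_lt_two_pow _⟩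
  have hN : ∀ i, ∃ r c, N r c = i := exists_cutPair_eq t π₁
  -- the patterns in `S` are `±1` and have `≤ D - 1` distinct rows
  have hpm : ∀ p ∈ S, ∀ i, p i = 1 ∨ p i = -1 := by
    intro p hp i
    obtain ⟨H, -, rfl⟩ := mem_image.mp hp
    exact liouville_succ_eq_or _
  have hrows : ∀ p ∈ S, (univ.image fun r : Fin t → Bool => fun c : Fin t → Bool => p (N r c)).card
      ≤ D - 1 := by
    intro p hp
    obtain ⟨H, -, rfl⟩ := mem_image.mp hp
    have hlt := hcon H
    rw [card_image_blockRows_eq] at hlt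
    have heq : (fun r : Fin t → Bool => fun c : Fin t → Bool =>
          (liouville (Nat.ofBits (fun j : Fin (2 * t) => Sum.elim r c (π₁.symm j)) +
            2 ^ (2 * t) * H + 1) : ℤ)) =
        (fun r : Fin t → Bool => fun c : Fin t → Bool =>
          (fun i : Fin (2 ^ (2 * t)) => (liouville (2 ^ (2 * t) * H + i + 1) : ℤ)) (N r c)) := by
      funext r c
      simp only [N, Nat.add_comm (Nat.ofBits _) (2 ^ (2 * t) * H)]
    rw [heq] at hlt
    omega
  have hcard := card_le_of_card_image_rows_le N hN (D - 1) S hpm hrows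
  rw [Nat.sub_add_cancel hD, Fintype.card_fun, Fintype.card_fin, Fintype.card_bool] at hcard
  -- `D^{2^t} · 2^{2^t D} ≤ 2^{D 2^t} · 2^{D 2^t} = 2^{2D · 2^t}`
  have hD2 : D ≤ 2 ^ D := (Nat.lt_two_pow_self).le
  have hbound : D ^ 2 ^ t * 2 ^ (2 ^ t * D) ≤ 2 ^ (2 * D * 2 ^ t) := by
    calc D ^ 2 ^ t * 2 ^ (2 ^ t * D) ≤ (2 ^ D) ^ 2 ^ t * 2 ^ (2 ^ t * D) :=
          Nat.mul_le_mul_right _ (Nat.pow_le_pow_left hD2 _)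
      _ = 2 ^ (2 * D * 2 ^ t) := by rw [← pow_mul, ← pow_add]; ring_nf
  exact absurd (hbig.trans_le (hcard.trans hbound)) (lt_irrefl _)

/-! ### §4 Positive sign-pattern entropy suffices -/

/-- **Windows from aligned blocks.**  The sign patterns of `λ` on the windows `[m + 1, m + B]`, `m < M`,
number at most `B · a²`, where `a` is the number of sign patterns of `λ` on the aligned blocks
`[B H + 1, B (H + 1)]`, `H < M / B + 2`: the window at `m = B H + i` (`i < B`) is read off `i` and the
two blocks `H`, `H + 1`. [folklore] -/
theorem card_windows_le (B M : ℕ) (hB : 0 < B) :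
    ((range M).image fun m : ℕ => fun j : Fin B => (liouville (m + j + 1) : ℤ)).card ≤
      B * (((range (M / B + 2)).image fun H : ℕ => fun j : Fin B =>
              (liouville (B * H + j + 1) : ℤ)).card *
            ((range (M / B + 2)).image fun H : ℕ => fun j : Fin B =>
              (liouville (B * H + j + 1) : ℤ)).card) := by
  classical
  set A : Finset (Fin B → ℤ) := (range (M / B + 2)).image fun H : ℕ => fun j : Fin B =>
      (liouville (B * H + j + 1) : ℤ) with hA
  -- glue two consecutive blocks at offset `i`
  let F : Fin B × ((Fin B → ℤ) × (Fin B → ℤ)) → (Fin B → ℤ) := fun x j =>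
    if h : (x.1 : ℕ) + j < B then x.2.1 ⟨x.1 + j, h⟩ else x.2.2 ⟨x.1 + j - B, by omega⟩
  have hsub : ((range M).image fun m : ℕ => fun j : Fin B => (liouville (m + j + 1) : ℤ)) ⊆
      (univ ×ˢ (A ×ˢ A)).image F := by
    intro w hw
    obtain ⟨m, hm, rfl⟩ := mem_image.mp hw
    rw [mem_range] at hm
    have hiB : m % B < B := Nat.mod_lt _ hB
    have hH : m / B < M / B + 2 := lt_of_le_of_lt (Nat.div_le_div_right hm.le) (by omega)
    have hH1 : m / B + 1 < M / B + 2 := by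
      have := Nat.div_le_div_right (c := B) hm.le; omega
    refine mem_image.mpr ⟨(⟨m % B, hiB⟩, ((fun j : Fin B => (liouville (B * (m / B) + j + 1) : ℤ)),
      (fun j : Fin B => (liouville (B * (m / B + 1) + j + 1) : ℤ)))), ?_, ?_⟩
    · simp only [mem_product, mem_univ, true_and, hA]
      exact ⟨mem_image.mpr ⟨m / B, mem_range.mpr hH, rfl⟩,
        mem_image.mpr ⟨m / B + 1, mem_range.mpr hH1, rfl⟩⟩
    · funext j
      have hm' : B * (m / B) + m % B = m := Nat.div_add_mod m B
      by_cases hj : m % B + (j : ℕ) < B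
      · simp only [F, hj, dite_true]
        congr 2; omega
      · simp only [F, hj, dite_false]
        congr 2
        rw [Nat.mul_succ]; omega
  calc ((range M).image fun m : ℕ => fun j : Fin B => (liouville (m + j + 1) : ℤ)).card
      ≤ ((univ ×ˢ (A ×ˢ A)).image F).card := card_le_card hsub
    _ ≤ (univ ×ˢ (A ×ˢ A) : Finset (Fin B × ((Fin B → ℤ) × (Fin B → ℤ)))).card := card_image_le
    _ = B * (A.card * A.card) := by rw [card_product, card_product, card_univ, Fintype.card_fin]

/-- ★ **Positive sign-pattern entropy of `λ` implies `LiouvilleCutRank`.**  If there is `η > 0` such that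
for every large `L` the Liouville sequence shows at least `2^{η L}` distinct sign patterns
`(λ(m + 1), …, λ(m + L))` (i.e. the subshift generated by `λ` has positive topological entropy — a
consequence of Sarnak's conjecture, a fortiori of Chowla's), then for every `W` eventually every
balanced cut matrix of `λ` has rank `≥ W`.  Proof: with `B = 4^t`, `card_windows_le` gives
`2^{η B} ≤ B · a(B)²`, so `a(B) > 2^{C · 2^t}` once `η 2^t ≥ 2C + 2`; apply
`liouvilleCutRank_of_blockComplexity`. [folklore] -/
theorem liouvilleCutRank_of_patternEntropy
    (h : ∃ η : ℝ, 0 < η ∧ ∃ L₀ : ℕ, ∀ L : ℕ, L₀ ≤ L → ∃ M : ℕ, (2 : ℝ) ^ (η * L) ≤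
      ((range M).image fun m : ℕ => fun j : Fin L => (liouville (m + j + 1) : ℤ)).card) :
    LiouvilleCutRank := by
  classical
  obtain ⟨η, hη, L₀, hL⟩ := h
  apply liouvilleCutRank_of_blockComplexity
  intro C
  -- a scale `t` with `η 2^t ≥ 2C + 2` and `4^t ≥ L₀`
  obtain ⟨t₁, ht₁⟩ := exists_nat_ge ((2 * C + 2) / η)
  set t : ℕ := max t₁ L₀ with ht
  have htt : (t : ℝ) ≤ (2 : ℝ) ^ t := by exact_mod_cast (Nat.lt_two_pow_self (n := t)).le
  have h2t : (2 * (C : ℝ) + 2) ≤ η * (2 : ℝ) ^ t := by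
    have h1 : (2 * (C : ℝ) + 2) / η ≤ (2 : ℝ) ^ t :=
      ht₁.trans ((Nat.cast_le.mpr (le_max_left t₁ L₀)).trans htt)
    rw [div_le_iff₀ hη] at h1
    linarith [h1]
  set B : ℕ := 2 ^ (2 * t) with hBdef
  have hBpos : 0 < B := Nat.two_pow_pos _
  have hL₀B : L₀ ≤ B := by
    have h1 : L₀ ≤ t := le_max_right _ _
    have h2 : t < 2 ^ t := Nat.lt_two_pow_self
    have h3 : 2 ^ t ≤ 2 ^ (2 * t) := Nat.pow_le_pow_right Nat.two_pos (by omega)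
    omega
  obtain ⟨M, hM⟩ := hL B hL₀B
  refine ⟨t, M / B + 2, ?_⟩
  set a : ℕ := ((range (M / B + 2)).image fun H : ℕ => fun j : Fin (2 ^ (2 * t)) =>
      (liouville (2 ^ (2 * t) * H + j + 1) : ℤ)).card with ha
  by_contra hle
  push Not at hle
  -- `2^{η B} ≤ B a² ≤ 2^{2t} (2^{C 2^t})² = 2^{2t + 2 C 2^t}`
  have hwin := card_windows_le B M hBpos
  rw [hBdef] at hwin
  have hchain : ((range M).image fun m : ℕ => fun j : Fin (2 ^ (2 * t)) =>
      (liouville (m + j + 1) : ℤ)).card ≤ 2 ^ (2 * t + 2 * (C * 2 ^ t)) := by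
    calc _ ≤ 2 ^ (2 * t) * (a * a) := hwin
      _ ≤ 2 ^ (2 * t) * (2 ^ (C * 2 ^ t) * 2 ^ (C * 2 ^ t)) :=
          Nat.mul_le_mul_left _ (Nat.mul_le_mul hle hle)
      _ = 2 ^ (2 * t + 2 * (C * 2 ^ t)) := by rw [← pow_add, ← pow_add]; ring_nf
  have hreal : (2 : ℝ) ^ (η * (B : ℕ)) ≤ (2 : ℝ) ^ ((2 * t + 2 * (C * 2 ^ t) : ℕ) : ℝ) := by
    rw [Real.rpow_natCast]
    refine hM.trans ?_
    rw [hBdef]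
    exact_mod_cast hchain
  have hexp : η * (B : ℕ) ≤ ((2 * t + 2 * (C * 2 ^ t) : ℕ) : ℝ) :=
    (Real.rpow_le_rpow_left_iff (by norm_num : (1 : ℝ) < 2)).mp hreal
  -- but `η B = (η 2^t) 2^t ≥ (2C + 2) 2^t > 2C 2^t + 2t`
  have hB2 : ((B : ℕ) : ℝ) = (2 : ℝ) ^ t * (2 : ℝ) ^ t := by
    rw [hBdef]; push_cast; rw [← pow_add]; ring_nf
  have hlow : (2 * (C : ℝ) + 2) * (2 : ℝ) ^ t ≤ η * (B : ℕ) := by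
    rw [hB2, ← mul_assoc]
    exact mul_le_mul_of_nonneg_right h2t (by positivity)
  have hcast : ((2 * t + 2 * (C * 2 ^ t) : ℕ) : ℝ) = 2 * (t : ℝ) + 2 * (C : ℝ) * (2 : ℝ) ^ t := by
    push_cast; ring
  rw [hcast] at hexp
  have hfin : (2 * (C : ℝ) + 2) * (2 : ℝ) ^ t ≤ 2 * (t : ℝ) + 2 * (C : ℝ) * (2 : ℝ) ^ t :=
    hlow.trans hexp
  have hlt : (t : ℝ) < (2 : ℝ) ^ t := by exact_mod_cast Nat.lt_two_pow_self (n := t)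
  have key : (2 : ℝ) ^ t ≤ t := by linarith [hfin]
  linarith [key, hlt]

end Summit.ValiantsHypothesis.ValiantsHypothesis.Theorems.LiouvilleSarnakLiouvilleCutRank.BlockEntropy
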